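import Literature.NumberTheory.Rogawski1990.SemilocalCharactersLinIndep     -- ★ `ArchTestKc` (+ ★ `archTr₀`, `globOfRecord`, `archProjUForm`)
import Literature.NumberTheory.Rogawski1990.GlobalAPacketMembership          -- ★ frame lemmas `transpose_map_cmConjRingHom_eq_of_frame`, `isUnit_det_of_frame`
import Literature.NumberTheory.Automorphic.UnitaryGroupArchUnimodular        -- ★ `modularCharacterFun_arch_eq_one` (unimodularity of `U(H)(L⁺ ⊗ ℝ)`)
import Literature.NumberTheory.Automorphic.UnitaryGroupArchTopology          -- ★ instances: `arch` locally compact, second countable, Hausdorff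
import Literature.NumberTheory.Automorphic.GLnAdelicIntegrationFactsProofs   -- ★ `isMulRightInvariant_of_modularCharacterFun_eq_one`
import Literature.NumberTheory.Automorphic.GLnIwasawaIntegration             -- ★ `isInvInvariant_of_isMulRightInvariant`
import Literature.NumberTheory.Automorphic.IntegratedOperatorStar            -- ★ `mulStar`, `ContRepresentation.adjoint_integratedOperator`
import HarnessLib

/-!
# The archimedean test functions are closed under `φ ↦ φ^*`, and the archimedean character satisfies `Θ_x(φ^*) = conj Θ_x(φ)`: reduction of
# complex to real coefficients in Rogawski's Prop. 13.8.1 (node A8 of the cell's statement tree)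

Topic `NumberTheory/Rogawski1990`; namespace `Literature.NumberTheory.Rogawski1990`.  THEOREMS ONLY (no definition, no instance, no notation, no `sorry`).
Cell `hodgecm-mathlib`, F0∕P3, typer topic T1 ([Rogawski1990, Prop. 13.8.1]: linear independence of characters; the printed argument is
[LabesseLanglands1979, Lemma 6.1 pp. 768–769] with REAL coefficients `l(π)`, and the reduction «`a(π) ∈ ℂ*`» → `ℝ` uses that the test algebra `B` is closed
under `f ↦ f^*` and that `tr π(f^*) = conj tr π(f)` for unitary `π`).  At the cell's archimedean group `G′_∞ = U(H)(L⁺ ⊗ ℝ)` with test class ★ `ArchTestKc`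
(smooth, compactly supported, bi-`K_c`-invariant) and character of record ★ `archTr₀`:

* §1 `IsArchSmooth.inv_archGroupGL` — archimedean smoothness (★ `IsArchSmooth`, RIGHT exponential charts) of `φ : GL₃(L ⊗ ℝ) → ℂ` passes to `g ↦ φ(g⁻¹)`:
  `(g·exp X)⁻¹ = g⁻¹ · exp(−Ad(g) X)` (★ `RealMatrixGroup.expMem_Ad`), a LINEAR change of chart.
* §2 `ArchTestKc.mulStar` — `φ ∈ ArchTestKc ⇒ φ^* ∈ ArchTestKc` (`φ^*(g) = conj φ(g⁻¹)`, ★ `mulStar`): the smooth compactly supported extension is `g ↦ conj φ'(g⁻¹)`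
  (§1 + ★ `IsArchSmooth.star`), and RIGHT∕LEFT `K_c`-invariance swap.
* §3 `archTr₀_mulStar` — `archTr₀ … νinf x (φ^*) = conj (archTr₀ … νinf x φ)` for a Haar `νinf` (any frame): on the good branch `ϖ(φ^*) = ϖ(φ)†`
  (★ `ContRepresentation.adjoint_integratedOperator`; `νinf` is inversion-invariant because `U(H)(L⁺ ⊗ ℝ)` is unimodular, ★ `modularCharacterFun_arch_eq_one` ∕
  ★ `isInvInvariant_of_isMulRightInvariant`) and `⟪e, A† e⟫ = conj ⟪e, A e⟫`; the junk branches correspond (`φ ↦ φ^*` is an involution preserving continuity and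
  compact support).
* §4 `archRealReduction` — **A8**: if the character sums of `a : Cinf → ℂ` against `ArchTestKc` are summable with sum `0`, so are those of `Re ∘ a` and `Im ∘ a`
  (TOKEN FOR TOKEN the text `ArchRealReduction` of typ-T1a's Lines draft `T1a_ArchCharactersLinIndep`, so that the fold is one term).
[cite: LabesseLanglands1979, Lemma 6.1 p. 768] [cite: Rogawski1990, Prop. 13.8.1 p. 206]

## References
* J.-P. Labesse, R. P. Langlands, *L-indistinguishability for SL(2)*, Canad. J. Math. 31 (1979), Lemma 6.1 pp. 768–769 [LabesseLanglands1979].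
* J. D. Rogawski, *Automorphic Representations of Unitary Groups in Three Variables* (1990), Prop. 13.8.1 p. 206 [Rogawski1990].
* A. Borel, H. Jacquet, Corvallis (1979), §1.1, §4.1 [BorelJacquet1979].
-/

set_option autoImplicit false

noncomputable section

open NumberField MeasureTheory CompactlySupported
open scoped Matrix ComplexConjugate InnerProductSpace

namespace Literature.NumberTheory.Rogawski1990

open Literature.NumberTheory.Automorphic Literature.NumberTheory.Automorphic.UnitaryGroup
open Literature.NumberTheory.Automorphic.UnitaryGroup.CotangentForms
open Literature.RepresentationTheory.KonnoKonno2007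

/-! ## §1 Archimedean smoothness under inversion on `GL_n(K ⊗ ℝ)` -/

section Inv

open NumberField.mixedEmbedding
-- `Classical`: the place subtypes indexing `mixedSpace K` are `Fintype` classically (`NormedCommRing (mixedSpace K)`), as in ★ `TestFunctions`;
-- `Matrix.Norms.Operator`: the operator norm on matrices, under which `𝔤.toSubmodule` is a normed space (as in ★ `GKModulesSmoothVectorsProofs`).
open scoped Matrix.Norms.Operator Classical ContDiff

/-- **`g ↦ φ(g⁻¹)` is smooth in the archimedean variable when `φ` is** (on the FULL linear real group `GL_n(K ⊗ ℝ)` = ★ `archGroupGL`, whose carrier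
is everything, so `Ad(g)` is available for every `g`): `φ((g·exp X)⁻¹) = φ(g⁻¹ · exp(Ad(g)(−X)))` (★ `RealMatrixGroup.expMem_Ad`: `exp(Ad g Y) = g (exp Y) g⁻¹`),
and `X ↦ Ad(g)(−X)` is a continuous linear map (★ `RealMatrixGroup.AdCLM`). Deliberate extension of the tree's `IsArchSmooth` dot-namespace.
[cite: BorelJacquet1979, §1.1] [folklore] -/
theorem _root_.Literature.NumberTheory.Automorphic.IsArchSmooth.inv_archGroupGL {K : Type} [Field K] [NumberField K] {n : ℕ}
    {φ : GL (Fin n) (mixedSpace K) → ℂ} (hφ : IsArchSmooth (archGroupGL n K).carrier.subtype φ) :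
    IsArchSmooth (archGroupGL n K).carrier.subtype fun g => φ g⁻¹ := by
  letI : LieRing (Matrix (Fin n) (Fin n) (mixedSpace K)) := LieRing.ofAssociativeRing
  intro g
  have hg : g ∈ (archGroupGL n K).carrier := by rw [archGroupGL_carrier]; exact Subgroup.mem_top g
  let gc : (archGroupGL n K).carrier := ⟨g, hg⟩
  let Lc : (archGroupGL n K).lie.toSubmodule →L[ℝ] (archGroupGL n K).lie.toSubmodule :=
    ((archGroupGL n K).AdCLM gc).comp (-(ContinuousLinearMap.id ℝ _))
  have h1 : ∀ X : (archGroupGL n K).lie.toSubmodule,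
      (⟨(Lc X : Matrix (Fin n) (Fin n) (mixedSpace K)), (Lc X).2⟩ : (archGroupGL n K).lie) = (archGroupGL n K).Ad gc (-⟨X, X.2⟩) := by
    intro X
    rfl
  have h2 : ∀ X : (archGroupGL n K).lie.toSubmodule,
      (archGroupGL n K).expMem (-⟨X, X.2⟩) = ((archGroupGL n K).expMem ⟨X, X.2⟩)⁻¹ := by
    intro X
    apply Subtype.ext
    rw [RealMatrixGroup.coe_expMem, Subgroup.coe_inv, RealMatrixGroup.coe_expMem, ← expGL_neg]
    rfl
  -- `(g · exp X)⁻¹ = g⁻¹ · exp(Ad g (−X))`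
  have hkey : ∀ X : (archGroupGL n K).lie.toSubmodule,
      (g * (archGroupGL n K).carrier.subtype ((archGroupGL n K).expMem ⟨X, X.2⟩))⁻¹ =
        g⁻¹ * (archGroupGL n K).carrier.subtype ((archGroupGL n K).expMem ⟨Lc X, (Lc X).2⟩) := by
    intro X
    rw [h1, RealMatrixGroup.expMem_Ad, h2]
    simp only [Subgroup.coe_subtype, Subgroup.coe_mul, Subgroup.coe_inv, mul_inv_rev]
    change _ = g⁻¹ * (g * _ * g⁻¹)
    rw [← mul_assoc, ← mul_assoc, inv_mul_cancel, one_mul]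
  have hfun : (fun X : (archGroupGL n K).lie.toSubmodule =>
        (fun g => φ g⁻¹) (g * (archGroupGL n K).carrier.subtype ((archGroupGL n K).expMem ⟨X, X.2⟩))) =
      (fun Y : (archGroupGL n K).lie.toSubmodule => φ (g⁻¹ * (archGroupGL n K).carrier.subtype ((archGroupGL n K).expMem ⟨Y, Y.2⟩))) ∘
        (Lc : _ → _) := by
    funext X
    rw [Function.comp_apply, ← hkey X]
  rw [hfun]
  exact (hφ g⁻¹).comp Lc.contDiff


end Inv

/-! ## §2 `ArchTestKc` is closed under `φ ↦ φ^*` -/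

section TestStar

open scoped Matrix.Norms.Operator Classical ContDiff

variable {L : Type} [Field L] [NumberField L] [IsCMField L] {ι : L →+* ℂ} {H : Matrix (Fin 3) (Fin 3) L} {T : GL (Fin 3) ℂ}
  {hT : (T : Matrix (Fin 3) (Fin 3) ℂ)ᴴ * H.map ι * (T : Matrix (Fin 3) (Fin 3) ℂ) = Literature.Geometry.ComplexHyperbolic.BallModel.J}

open scoped Classical in
/-- **`φ ∈ ArchTestKc ⇒ φ^* ∈ ArchTestKc`** (`φ^*(g) = conj φ(g⁻¹)`, ★ `mulStar`): the extension to `GL₃(L ⊗ ℝ)` is `g ↦ conj φ'(g⁻¹)` — continuous, compactly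
supported (inversion is a homeomorphism), smooth in the archimedean variable (§1 + ★ `IsArchSmooth.star`) — and right (resp. left) `K_c`-invariance of `φ^*`
is left (resp. right) `K_c`-invariance of `φ` at `k⁻¹ ∈ K_c`. «`B` is closed under `f → f^*`» [cite: LabesseLanglands1979, Lemma 6.1 p. 768]
[cite: Rogawski1990, §14.2 p. 233] -/
theorem ArchTestKc.mulStar {φ : UnitaryGroup.arch (↥(maximalRealSubfield L)) L (IsCMField.complexConj L) 3 H → ℂ}
    (hφ : ArchTestKc L ι H T hT φ) : ArchTestKc L ι H T hT (mulStar φ) := by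
  obtain ⟨⟨φ', hφ'c, hφ's, hφ'sm, hφ'⟩, hright, hleft⟩ := hφ
  refine ⟨⟨fun g => conj (φ' g⁻¹), ?_, ?_, ?_, ?_⟩, ?_, ?_⟩
  · exact Complex.continuous_conj.comp (hφ'c.comp continuous_inv)
  · have h1 : HasCompactSupport (fun g : GL (Fin 3) (NumberField.mixedEmbedding.mixedSpace L) => φ' g⁻¹) :=
      hφ's.comp_homeomorph (Homeomorph.inv (GL (Fin 3) (NumberField.mixedEmbedding.mixedSpace L)))
    exact h1.comp_left (g := fun z : ℂ => conj z) (map_zero _)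
  · -- conjugation is a continuous real-linear map of `ℂ` (the proof of ★ `IsArchSmooth.star`), after §1 for the inversion
    exact fun g => Complex.conjCLE.contDiff.comp ((IsArchSmooth.inv_archGroupGL hφ'sm) g)
  · intro k
    rw [mulStar_apply, hφ' k⁻¹]
    simp only [Subgroup.coe_inv]
  · intro k hk a
    have h1 := hleft k⁻¹ (inv_mem hk) a⁻¹
    rw [mulStar_apply, mulStar_apply, mul_inv_rev]
    congr 1
  · intro k hk a
    have h1 := hright k⁻¹ (inv_mem hk) a⁻¹
    rw [mulStar_apply, mulStar_apply, mul_inv_rev]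
    congr 1

/-- `mulStar` is an involution on functions `G → ℂ`. [folklore] -/
private theorem mulStar_mulStar {G : Type*} [Group G] (f : G → ℂ) : Literature.NumberTheory.Automorphic.mulStar (mulStar f) = f := by
  funext g
  rw [mulStar_apply, mulStar_apply, inv_inv, Complex.conj_conj]

/-- Continuity passes to `φ^*`. [folklore] -/
private theorem continuous_mulStar {G : Type*} [Group G] [TopologicalSpace G] [ContinuousInv G] {f : G → ℂ} (hf : Continuous f) :
    Continuous (mulStar f) :=
  Complex.continuous_conj.comp (hf.comp continuous_inv)

/-- Compact support passes to `φ^*`. [folklore] -/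
private theorem hasCompactSupport_mulStar {G : Type*} [Group G] [TopologicalSpace G] [ContinuousInv G] {f : G → ℂ} (hf : HasCompactSupport f) :
    HasCompactSupport (mulStar f) :=
  (hf.comp_homeomorph (Homeomorph.inv G)).comp_left (g := fun z : ℂ => conj z) (map_zero _)

end TestStar

/-! ## §3 `Θ_x(φ^*) = conj Θ_x(φ)` for the archimedean character of record -/

section CharStar

variable (L : Type) [Field L] [NumberField L] [IsCMField L] (ι : L →+* ℂ) (H : Matrix (Fin 3) (Fin 3) L) (T : GL (Fin 3) ℂ)
  (hT : (T : Matrix (Fin 3) (Fin 3) ℂ)ᴴ * H.map ι * (T : Matrix (Fin 3) (Fin 3) ℂ) = Literature.Geometry.ComplexHyperbolic.BallModel.J)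

/-- **Diagonal coefficients of `π(f^*)` are the conjugates of those of `π(f)`** for a unitary strongly continuous `π` and an inversion-invariant measure:
`π(f^*) = π(f)†` (★ `adjoint_integratedOperator`) and `⟪e, A† e⟫ = ⟪A e, e⟫ = conj ⟪e, A e⟫`; hence the diagonal sums along any family are conjugate
(Mathlib `tsum` commutes with the continuous additive `conj`, junk values included). [folklore] [cite: LabesseLanglands1979, Lemma 6.1 p. 768] -/
theorem tsum_inner_integratedOperator_mulStar {G E : Type*} [Group G] [TopologicalSpace G] [IsTopologicalGroup G] [MeasurableSpace G] [BorelSpace G]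
    [NormedAddCommGroup E] [InnerProductSpace ℂ E] [CompleteSpace E] {π : ContRepresentation ℂ G E}
    (hu : π.IsUnitary) (hc : π.IsStronglyContinuous) (η : Measure G) [IsFiniteMeasureOnCompacts η] [η.IsInvInvariant]
    (f fs : C_c(G, ℂ)) (hfs : ∀ x, fs x = mulStar (⇑f) x) {κ : Type*} (e : κ → E) :
    ∑' k, ⟪e k, π.integratedOperator hu hc η fs (e k)⟫_ℂ = conj (∑' k, ⟪e k, π.integratedOperator hu hc η f (e k)⟫_ℂ) := by
  rw [Complex.conj_tsum]
  refine tsum_congr fun k => ?_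
  rw [← ContRepresentation.adjoint_integratedOperator hu hc η f fs hfs, ContinuousLinearMap.adjoint_inner_right, inner_conj_symm]

include hT in
/-- **`archTr₀ … νinf x (φ^*) = conj (archTr₀ … νinf x φ)` for a Haar measure `νinf` on `G′_∞ = U(H)(L⁺ ⊗ ℝ)`** (any CM frame): on the good branch the pulled-back
globalization of record is unitary and strongly continuous and `νinf` is inversion-invariant (`U(H)(L⁺ ⊗ ℝ)` is unimodular: ★ `modularCharacterFun_arch_eq_one` with
`ᵗH̄ = H`, `det H ≠ 0` from the frame, ★ `isMulRightInvariant_of_modularCharacterFun_eq_one`, ★ `isInvInvariant_of_isMulRightInvariant`), so the previous lemma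
applies; the junk branches of ★ `archTr₀` for `φ` and `φ^*` coincide. [cite: LabesseLanglands1979, Lemma 6.1 p. 768] [cite: Rogawski1990, Prop. 13.8.1 p. 206] -/
theorem archTr₀_mulStar (νinf : @Measure (UnitaryGroup.arch (↥(maximalRealSubfield L)) L (IsCMField.complexConj L) 3 H) (borel _))
    (hν : @Measure.IsHaarMeasure _ _ _ (borel _) νinf) (x : GKIrrClass (uFormGroup (Fin 2) (Fin 1)))
    (φ : UnitaryGroup.arch (↥(maximalRealSubfield L)) L (IsCMField.complexConj L) 3 H → ℂ) :
    archTr₀ L ι H T hT νinf x (mulStar φ) = conj (archTr₀ L ι H T hT νinf x φ) := by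
  letI : MeasurableSpace (UnitaryGroup.arch (↥(maximalRealSubfield L)) L (IsCMField.complexConj L) 3 H) := borel _
  haveI : BorelSpace (UnitaryGroup.arch (↥(maximalRealSubfield L)) L (IsCMField.complexConj L) 3 H) := ⟨rfl⟩
  haveI : νinf.IsHaarMeasure := hν
  by_cases h : HasUnitaryGlobalization (uFormGroup (Fin 2) (Fin 1)) x ∧ (Continuous φ ∧ HasCompactSupport φ) ∧ IsFiniteMeasureOnCompacts νinf
  · obtain ⟨hx, ⟨hφc, hφs⟩, hfin⟩ := h
    have hφc' : Continuous (mulStar φ) := continuous_mulStar hφc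
    have hφs' : HasCompactSupport (mulStar φ) := hasCompactSupport_mulStar hφs
    rw [archTr₀_eq_tsum L ι H T hT νinf x (mulStar φ) hx hφc' hφs' hfin, archTr₀_eq_tsum L ι H T hT νinf x φ hx hφc hφs hfin]
    -- inversion invariance of the Haar measure `νinf` (unimodularity of `U(H)(L⁺ ⊗ ℝ)`)
    haveI : νinf.IsMulRightInvariant :=
      isMulRightInvariant_of_modularCharacterFun_eq_one
        (fun g => modularCharacterFun_arch_eq_one L H (transpose_map_cmConjRingHom_eq_of_frame L ι H T hT)
          (isUnit_det_of_frame L ι H T hT).ne_zero g) νinf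
    haveI : νinf.IsInvInvariant := isInvInvariant_of_isMulRightInvariant νinf
    exact tsum_inner_integratedOperator_mulStar _ _ νinf ⟨⟨φ, hφc⟩, hφs⟩ ⟨⟨mulStar φ, hφc'⟩, hφs'⟩ (fun _ => rfl) _
  · have h' : ¬ (HasUnitaryGlobalization (uFormGroup (Fin 2) (Fin 1)) x ∧ (Continuous (mulStar φ) ∧ HasCompactSupport (mulStar φ)) ∧
        IsFiniteMeasureOnCompacts νinf) := by
      rintro ⟨hx, ⟨hφc', hφs'⟩, hfin⟩
      refine h ⟨hx, ⟨?_, ?_⟩, hfin⟩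
      · simpa only [mulStar_mulStar] using continuous_mulStar hφc'
      · simpa only [mulStar_mulStar] using hasCompactSupport_mulStar hφs'
    rw [archTr₀_of_not L ι H T hT νinf x _ h', archTr₀_of_not L ι H T hT νinf x _ h, map_zero]

end CharStar


/-! ## §4 A8 — from complex to real coefficients -/

section RealReduction

open scoped Classical ComplexOrder

/-- **A8 `ArchRealReduction` — COMPLEX TO REAL COEFFICIENTS** (TOKEN FOR TOKEN the text `ArchRealReduction` of typ-T1a's Lines draft for [Rogawski1990, Prop. 13.8.1]):
at a Haar `νinf`, if the character sums of `a : Cinf → ℂ` against `ArchTestKc` are summable with sum `0`, so are those of `Re ∘ a` and of `Im ∘ a`.  PROOF: for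
`φ ∈ ArchTestKc` also `φ^* ∈ ArchTestKc` (§2) and `Θ_y(φ^*) = conj Θ_y(φ)` (§3), so `y ↦ conj (a y) · Θ_y(φ) = conj (a y · Θ_y(φ^*))` is summable with sum `conj 0 = 0`;
now `Re (a y) = (a y + conj (a y)) ∕ 2` and `Im (a y) = (a y − conj (a y)) ∕ (2i)`. [cite: LabesseLanglands1979, Lemma 6.1 p. 768]
[cite: Rogawski1990, Prop. 13.8.1 p. 206] -/
theorem archRealReduction :
    ∀ (L : Type) [Field L] [NumberField L] [IsCMField L] (ι : L →+* ℂ) (H : Matrix (Fin 3) (Fin 3) L) (T : GL (Fin 3) ℂ)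
      (hT : (T : Matrix (Fin 3) (Fin 3) ℂ)ᴴ * H.map ι * (T : Matrix (Fin 3) (Fin 3) ℂ) = Literature.Geometry.ComplexHyperbolic.BallModel.J)
      (νinf : @Measure (UnitaryGroup.arch (↥(maximalRealSubfield L)) L (IsCMField.complexConj L) 3 H) (borel _)),
      @Measure.IsHaarMeasure _ _ _ (borel _) νinf →
      ∀ (a : GKIrrClass (uFormGroup (Fin 2) (Fin 1)) → ℂ),
        (∀ φ : UnitaryGroup.arch (↥(maximalRealSubfield L)) L (IsCMField.complexConj L) 3 H → ℂ,
            ArchTestKc L ι H T hT φ → Summable fun y => a y * archTr₀ L ι H T hT νinf y φ) →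
        (∀ φ : UnitaryGroup.arch (↥(maximalRealSubfield L)) L (IsCMField.complexConj L) 3 H → ℂ,
            ArchTestKc L ι H T hT φ → ∑' y, a y * archTr₀ L ι H T hT νinf y φ = 0) →
        ((∀ φ : UnitaryGroup.arch (↥(maximalRealSubfield L)) L (IsCMField.complexConj L) 3 H → ℂ,
              ArchTestKc L ι H T hT φ → Summable fun y => ((a y).re : ℂ) * archTr₀ L ι H T hT νinf y φ) ∧
          (∀ φ : UnitaryGroup.arch (↥(maximalRealSubfield L)) L (IsCMField.complexConj L) 3 H → ℂ,
              ArchTestKc L ι H T hT φ → ∑' y, ((a y).re : ℂ) * archTr₀ L ι H T hT νinf y φ = 0)) ∧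
        ((∀ φ : UnitaryGroup.arch (↥(maximalRealSubfield L)) L (IsCMField.complexConj L) 3 H → ℂ,
              ArchTestKc L ι H T hT φ → Summable fun y => ((a y).im : ℂ) * archTr₀ L ι H T hT νinf y φ) ∧
          (∀ φ : UnitaryGroup.arch (↥(maximalRealSubfield L)) L (IsCMField.complexConj L) 3 H → ℂ,
              ArchTestKc L ι H T hT φ → ∑' y, ((a y).im : ℂ) * archTr₀ L ι H T hT νinf y φ = 0)) := by
  intro L _ _ _ ι H T hT νinf hν a hsum h0
  -- the conjugate family: `y ↦ conj (a y) · Θ_y(φ)`, summable with sum `0` (via `φ^*`)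
  have hconj : ∀ φ : UnitaryGroup.arch (↥(maximalRealSubfield L)) L (IsCMField.complexConj L) 3 H → ℂ, ArchTestKc L ι H T hT φ →
      HasSum (fun y => conj (a y) * archTr₀ L ι H T hT νinf y φ) 0 := by
    intro φ hφ
    have hφs : ArchTestKc L ι H T hT (mulStar φ) := hφ.mulStar
    have h1 : HasSum (fun y => a y * archTr₀ L ι H T hT νinf y (mulStar φ)) 0 := by
      rw [← h0 _ hφs]
      exact (hsum _ hφs).hasSum
    have h2 := h1.map (starRingEnd ℂ) Complex.continuous_conj
    rw [map_zero] at h2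
    refine h2.congr_fun fun y => ?_
    change conj (a y) * archTr₀ L ι H T hT νinf y φ = conj (a y * archTr₀ L ι H T hT νinf y (mulStar φ))
    rw [map_mul, archTr₀_mulStar L ι H T hT νinf hν y φ, Complex.conj_conj]
  have hplain : ∀ φ : UnitaryGroup.arch (↥(maximalRealSubfield L)) L (IsCMField.complexConj L) 3 H → ℂ, ArchTestKc L ι H T hT φ →
      HasSum (fun y => a y * archTr₀ L ι H T hT νinf y φ) 0 := by
    intro φ hφ
    rw [← h0 _ hφ]
    exact (hsum _ hφ).hasSum
  -- real parts: `(a + conj a) / 2`; imaginary parts: `(a − conj a) / (2 I)`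
  have hre : ∀ φ : UnitaryGroup.arch (↥(maximalRealSubfield L)) L (IsCMField.complexConj L) 3 H → ℂ, ArchTestKc L ι H T hT φ →
      HasSum (fun y => ((a y).re : ℂ) * archTr₀ L ι H T hT νinf y φ) 0 := by
    intro φ hφ
    have h := ((hplain φ hφ).add (hconj φ hφ)).div_const 2
    rw [add_zero, zero_div] at h
    refine h.congr_fun fun y => ?_
    change ((a y).re : ℂ) * archTr₀ L ι H T hT νinf y φ = (a y * archTr₀ L ι H T hT νinf y φ + conj (a y) * archTr₀ L ι H T hT νinf y φ) / 2
    rw [Complex.re_eq_add_conj]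
    ring
  have him : ∀ φ : UnitaryGroup.arch (↥(maximalRealSubfield L)) L (IsCMField.complexConj L) 3 H → ℂ, ArchTestKc L ι H T hT φ →
      HasSum (fun y => ((a y).im : ℂ) * archTr₀ L ι H T hT νinf y φ) 0 := by
    intro φ hφ
    have h := ((hplain φ hφ).sub (hconj φ hφ)).div_const (2 * Complex.I)
    rw [sub_zero, zero_div] at h
    refine h.congr_fun fun y => ?_
    change ((a y).im : ℂ) * archTr₀ L ι H T hT νinf y φ =
      (a y * archTr₀ L ι H T hT νinf y φ - conj (a y) * archTr₀ L ι H T hT νinf y φ) / (2 * Complex.I)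
    rw [Complex.im_eq_sub_conj]
    field_simp
  exact ⟨⟨fun φ hφ => (hre φ hφ).summable, fun φ hφ => (hre φ hφ).tsum_eq⟩,
    ⟨fun φ hφ => (him φ hφ).summable, fun φ hφ => (him φ hφ).tsum_eq⟩⟩

end RealReduction

end Literature.NumberTheory.Rogawski1990

end
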